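import Literature.NumberTheory.ComplexMultiplication.KottwitzSignatureReflexField
import Mathlib.FieldTheory.PrimitiveElement
import HarnessLib

/-!
# The reflex field of a signature is generated by the determinants: `E_r = ℚ(det(a ∣ V₁) ∣ a ∈ F)`
# `= ℚ(∏_φ φ(a)^{r_φ} ∣ a ∈ F)` = the field generated by the coefficients of the polynomials `det(X − a ∣ V₁)`,
# = the field generated by the values of Kottwitz's `f(X₁, …, X_t) = det(X₁α₁ + ⋯ + X_tα_t ; V₁)` at rational points

Layer `Literature/NumberTheory/ComplexMultiplication`, namespace `Literature.NumberTheory.ComplexMultiplication` (lane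
`lit-hodgefound`, Track 2 foundations, Layer A3; seat `lit-hodgefound-p11`, generation 30, row g30-#3).  Sequel of
`KottwitzSignatureReflexField` (g28-#4: `E_r = ℚ(∑_φ r_φ φ(a) ∣ a ∈ F)` WRITTEN OUT as
`IntermediateField.adjoin ℚ (Set.range fun a : F => ∑ φ : F →+* ℂ, (r φ : ℂ) * φ a)`, `Aut(ℂ/E_r) = Stab(r)`, and §3
«these coefficients lie in `E`»: `coeff_prod_X_sub_C_pow_mem_adjoin_sum`, `prod_apply_pow_mem_adjoin_sum`).  THEOREMS ONLY
(D-0026): no definition, no named fact, no instance.  This file proves the CONVERSE inclusions.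

THE PRINT.  R. E. Kottwitz, *Points on some Shimura varieties over finite fields*, J. Amer. Math. Soc. 5 (1992)
[Kottwitz1992] §5 pp. 389–390 (held text `paper:doi-10-2307-2152772` p0017 L43–L50, p0018 L17–L26), verbatim: «Let
`E ⊂ ℂ` be the field of definition of the isomorphism class of the complex representation `V₁` of `B`; the number field
`E` is called the reflex field.  Choose a basis `α₁, …, α_t` […] and let `X₁, …, X_t` be indeterminates.  Then
`f(X₁, …, X_t) := det(X₁α₁ + ⋯ + X_tα_t ; V₁)` is a homogeneous polynomial of degree `dim_ℂ(V₁)` in `X₁, …, X_t` with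
coefficients in `ℂ`; since the isomorphism class of `V₁` is defined over `E`, these coefficients lie in `E`.» and «Let
`E` be a finite-dimensional semisimple algebra over a field `k`, and let `α₁, …, α_t` be a `k`-basis for `E`.  For any
finite-dimensional `E`-module `V` define a polynomial `det_V ∈ k[X₁, …, X_t]` by
`det_V = det(X₁α₁ + ⋯ + X_tα_t ; V ⊗_k k[X₁, …, X_t])`.  Then `V` is isomorphic to `W` if and only if `det_V = det_W`.
[…] The proof is easy: replacing `E` by its center and `k` by its algebraic closure, it is enough to prove the statement
for `E = k × ⋯ × k`, in which case it is obvious.»  THE TWO SENTENCES TOGETHER say that `E` is ALSO the field of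
definition of `det_{V₁}` — `τ ∈ Aut(ℂ)` fixes the class of `V₁` iff it fixes `det_{V₁}` —, i.e. that `E` is GENERATED by
the coefficients of `f`, equivalently (Zariski density of `ℚ^t`, or: `f(x) = det(∑ xᵢαᵢ ∣ V₁)` runs through
`det(a ∣ V₁)`, `a ∈ F`) by its values at rational points; for `B = F` a number field, `V₁ = ⊕_φ φ^{r_φ}` and
`det(a ∣ V₁) = ∏_φ φ(a)^{r_φ}`, `det(X − a ∣ V₁) = ∏_φ (X − φ(a))^{r_φ}`.  The «obvious» case `E = k × ⋯ × k` is the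
MULTIPLICATIVE INDEPENDENCE OF THE EMBEDDINGS WITH MULTIPLICITIES (`∏_φ φ(a)^{r_φ} = ∏_φ φ(a)^{s_φ}` for all `a` forces
`r = s`): at a primitive element `α` of `F/ℚ` and `a = t − α`, `t ∈ ℚ`, the two sides are the values at `t` of the
polynomials `∏_φ (X − φ(α))^{r_φ}`, `∏_φ (X − φ(α))^{s_φ}`, which therefore coincide, and the `φ(α)` are pairwise
distinct (the tree's `TypeNorm.finset_eq_of_prod_apply_eq` is the case `r, s ∈ {0, 1}`; g27-#1's
`eq_card_fibre_of_charpoly_lieAction_eq_prod_pow` the pair-level version).  G. Shimura [Shimura1998] §8.3 Prop. 29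
(`β = ∏_j α^{ψ_j}`, the type norm — the case `r = 𝟙_Φ`: `det(a ∣ V₁) = N_Φ(a)`), Prop. 28 (`K* = ℚ(∑ᵢ ξ^{φᵢ})`).
S. Lang [Lang2002] VIII §1 (the Galois correspondence inside `ℂ`, the tree's `Complex.mem_subfield_of_forall_ringEquiv`
through g28-#4's `adjoin_sum_le_iff_forall`).

WHAT IS PROVED (`F` a number field, `r : (F →+* ℂ) → ℕ` any signature; `E_r` as displayed above).
§1 `apply_prod_apply_pow` (`τ(∏_φ φ(a)^{r_φ}) = ∏_ψ ψ(a)^{r_{τ⁻¹ψ}}`), **`eq_of_forall_prod_apply_pow_eq`** (multiplicative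
   independence with multiplicities: `(∀ a, ∏_φ φ(a)^{r_φ} = ∏_φ φ(a)^{s_φ}) → r = s`),
   **`forall_apply_prod_pow_eq_iff`** (`τ` fixes every `det(a ∣ V₁)` iff `r ∘ τ = r` — the multiplicative twin of g28-#4's
   `forall_apply_sum_eq_iff_forall_apply_smul_eq`).
§2 **`adjoin_prod_pow_eq_adjoin_sum`** — `ℚ(∏_φ φ(a)^{r_φ} ∣ a ∈ F) = E_r`: THE REFLEX FIELD IS GENERATED BY THE DETERMINANTS;
   `forall_mem_adjoin_prod_pow_iff` (`Aut(ℂ/ℚ(det)) = Stab(r)`), `mem_adjoin_prod_pow_iff_forall`.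
§3 **`adjoin_coeff_prod_X_sub_C_pow_eq_adjoin_sum`** — `E_r` is generated by the coefficients of the polynomials
   `det(X − a ∣ V₁) = ∏_φ (X − φ(a))^{r_φ}`, `a ∈ F` (the converse of «these coefficients lie in `E`»; the constant
   coefficients are `± det(a ∣ V₁)`).
§4 **`adjoin_prod_pow_repr_eq_adjoin_sum`** — for a `ℚ`-basis `α` of `F`: `E_r = ℚ(f(x) ∣ x ∈ ℚ^t)`, the values
   `f(x) = det(∑ xᵢαᵢ ∣ V₁) = ∏_φ (∑ᵢ xᵢ φ(αᵢ))^{r_φ}` of Kottwitz's `f` at rational points.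
§5 `r = 𝟙_Φ`: `prod_pow_ite_eq_prod_toFinset` (`∏_φ φ(a)^{𝟙_Φ(φ)} = ∏_{φ ∈ Φ} φ(a) = N_Φ(a)`) and
   **`traceField_eq_adjoin_prod`** — `K* = ℚ(tr_Φ(K)) = ℚ(N_Φ(a) ∣ a ∈ K)`: THE REFLEX FIELD OF A CM TYPE IS GENERATED BY
   THE TYPE NORMS (Prop. 28 with Prop. 29's `β`).

## References

* [Kottwitz1992] R. E. Kottwitz, *Points on some Shimura varieties over finite fields*, J. Amer. Math. Soc. 5 (1992)
  373–444, §5 pp. 389–390.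
* [Shimura1998] G. Shimura, *Abelian Varieties with Complex Multiplication and Modular Functions* (1998), §8.3
  Prop. 28, Prop. 29.
* [Lang2002] S. Lang, *Algebra*, 3rd ed. (2002), V §4 Thm. 4.6 (primitive element), VIII §1.
* [MilneFT2022] J. S. Milne, *Fields and Galois Theory* (2022), Thm. 5.1 (primitive element), Prop. 2.7.

## Provenance

Lane `lit-hodgefound` (HOME `run/shared/lean/pub/lit-hodgefound/`), prover seat `lit-hodgefound-p11` (gen 30),
self-proposed row g30-#3 (lane INBOX claim 2026-08-28), sequel of g28-#4 and g29-#2.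
-/

set_option autoImplicit false

noncomputable section

open scoped Polynomial Classical
open NumberField Module IntermediateField Polynomial

namespace Literature.NumberTheory.ComplexMultiplication

open Literature.AlgebraicGeometry.Motives (CMType)

variable {F : Type} [Field F] [NumberField F]

/-! ## §0 Preliminaries: a primitive element separates the embeddings; root counts -/

section Prelim

/-- Distinct complex embeddings take distinct values at a primitive element: `ℚ(α) = F ⟹ (φ ↦ φ(α))` injective.
[cite: MilneFT2022, Thm. 5.1 and Prop. 2.7] -/
private theorem apply_injective_of_adjoin_eq_top_dt {a : F} (ha : ℚ⟮a⟯ = ⊤) :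
    Function.Injective fun φ : F →+* ℂ => (φ a : ℂ) := by
  intro φ ψ h
  have hadj : Algebra.adjoin ℚ {a} = ⊤ := by
    rw [← IntermediateField.adjoin_simple_toSubalgebra_of_isAlgebraic (Algebra.IsAlgebraic.isAlgebraic a), ha,
      IntermediateField.top_toSubalgebra]
  have halg : φ.toRatAlgHom = ψ.toRatAlgHom :=
    AlgHom.ext_of_adjoin_eq_top hadj fun y hy => by
      rw [Set.mem_singleton_iff.1 hy, RingHom.toRatAlgHom_apply, RingHom.toRatAlgHom_apply]
      exact h
  exact RingHom.equivRatAlgHom.injective halg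

/-- Root count of `∏_φ (X − φ(a))^{m_φ}` at a value `φ₀(a)` separating the embeddings: it is `m_{φ₀}`.
[cite: Kottwitz1992, §5 (p. 390, «in which case it is obvious»)] -/
private theorem count_roots_prod_pow_dt {a : F} (hinj : Function.Injective fun φ : F →+* ℂ => (φ a : ℂ))
    (m : (F →+* ℂ) → ℕ) (φ₀ : F →+* ℂ) :
    (∏ φ : F →+* ℂ, (X - C (φ a : ℂ)) ^ m φ).roots.count (φ₀ a : ℂ) = m φ₀ := by
  have hprod : ∏ φ : F →+* ℂ, (X - C (φ a : ℂ)) ^ m φ ≠ 0 :=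
    Finset.prod_ne_zero_iff.2 fun φ _ => pow_ne_zero _ (X_sub_C_ne_zero (φ a : ℂ))
  rw [← Finset.mul_prod_erase Finset.univ (fun φ : F →+* ℂ => (X - C (φ a : ℂ)) ^ m φ) (Finset.mem_univ φ₀)]
    at hprod ⊢
  have hrest : ((∏ φ ∈ Finset.univ.erase φ₀, (X - C (φ a : ℂ)) ^ m φ).roots.count (φ₀ a : ℂ)) = 0 := by
    rw [Multiset.count_eq_zero, mem_roots (right_ne_zero_of_mul hprod), IsRoot.def, eval_prod,
      Finset.prod_eq_zero_iff]
    rintro ⟨φ, hφ, h0⟩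
    rw [eval_pow, eval_sub, eval_X, eval_C] at h0
    exact Finset.ne_of_mem_erase hφ (hinj (sub_eq_zero.1 (eq_zero_of_pow_eq_zero h0)).symm)
  rw [roots_mul hprod, Multiset.count_add, roots_pow, Multiset.count_nsmul, roots_X_sub_C,
    Multiset.count_singleton_self, mul_one, hrest, add_zero]

/-- `(∏_φ (X − φ(α))^{m_φ})(t) = ∏_φ (t − φ(α))^{m_φ} = ∏_φ φ(t − α)^{m_φ}` for `t ∈ ℚ`. [cite: Kottwitz1992, §5 p. 390] -/
private theorem eval_prod_X_sub_C_pow_dt (m : (F →+* ℂ) → ℕ) (a : F) (t : ℚ) :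
    (∏ φ : F →+* ℂ, (X - C (φ a : ℂ)) ^ m φ).eval (t : ℂ) = ∏ φ : F →+* ℂ, φ (algebraMap ℚ F t - a) ^ m φ := by
  rw [eval_prod]
  refine Finset.prod_congr rfl fun φ _ => ?_
  rw [eval_pow, eval_sub, eval_X, eval_C, map_sub, eq_ratCast, map_ratCast]

/-- A subfield of a number field inside `ℂ` is a number field. [folklore] -/
private theorem finiteDimensional_of_le_dt {E E' : IntermediateField ℚ ℂ} [FiniteDimensional ℚ E] (h : E' ≤ E) :
    FiniteDimensional ℚ E' :=
  FiniteDimensional.of_injective (IntermediateField.inclusion h).toLinearMap (IntermediateField.inclusion_injective h)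

end Prelim

/-! ## §1 Multiplicative independence of the embeddings, with multiplicities -/

section Independence

variable (r : (F →+* ℂ) → ℕ)

omit [NumberField F] in
/-- `τ(∏_φ φ(a)^{r_φ}) = ∏_ψ ψ(a)^{r_{τ⁻¹ψ}}`: `τ` carries `det(a ∣ V₁)` to `det(a ∣ V₁^τ)`. [cite: Kottwitz1992, §5 p. 390] -/
theorem apply_prod_apply_pow [Fintype (F →+* ℂ)] (τ : ℂ ≃+* ℂ) (a : F) :
    τ (∏ φ : F →+* ℂ, φ a ^ r φ) = ∏ ψ : F →+* ℂ, ψ a ^ r (τ⁻¹ • ψ) := by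
  rw [map_prod]
  simp only [map_pow]
  exact Fintype.prod_equiv (MulAction.toPerm τ) _ _ fun φ => by
    simp only [MulAction.toPerm_apply, inv_smul_smul, ringEquiv_smul_apply]

/-- **MULTIPLICATIVE INDEPENDENCE OF THE EMBEDDINGS, WITH MULTIPLICITIES** («`V ≅ W` iff `det_V = det_W` … for
`E = k × ⋯ × k` … obvious»): if `∏_φ φ(a)^{r_φ} = ∏_φ φ(a)^{s_φ}` for every `a ∈ F` then `r = s`.  Proof: at a primitive
element `α` of `F/ℚ` and `a = t − α` (`t ∈ ℚ`) both sides are the values at `t` of `∏_φ (X − φ(α))^{r_φ}` and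
`∏_φ (X − φ(α))^{s_φ}`; two complex polynomials agreeing on `ℚ` are equal, and the root `φ(α)` has multiplicity `r_φ`,
resp. `s_φ`, the `φ(α)` being pairwise distinct. [cite: Kottwitz1992, §5 (p. 390)] [cite: MilneFT2022, Thm. 5.1] -/
theorem eq_of_forall_prod_apply_pow_eq {r s : (F →+* ℂ) → ℕ}
    (h : ∀ a : F, ∏ φ : F →+* ℂ, φ a ^ r φ = ∏ φ : F →+* ℂ, φ a ^ s φ) : r = s := by
  obtain ⟨α, hα⟩ := Field.exists_primitive_element ℚ F
  have hinj := apply_injective_of_adjoin_eq_top_dt hα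
  have hpoly : (∏ φ : F →+* ℂ, (X - C (φ α : ℂ)) ^ r φ) = ∏ φ : F →+* ℂ, (X - C (φ α : ℂ)) ^ s φ := by
    refine Polynomial.eq_of_infinite_eval_eq _ _ (Set.infinite_of_injective_forall_mem
      (f := fun t : ℚ => (t : ℂ)) Rat.cast_injective fun t => ?_)
    change (∏ φ : F →+* ℂ, (X - C (φ α : ℂ)) ^ r φ).eval (t : ℂ) = (∏ φ : F →+* ℂ, (X - C (φ α : ℂ)) ^ s φ).eval (t : ℂ)
    rw [eval_prod_X_sub_C_pow_dt, eval_prod_X_sub_C_pow_dt, h]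
  funext φ₀
  have h1 := count_roots_prod_pow_dt hinj r φ₀
  have h2 := count_roots_prod_pow_dt hinj s φ₀
  rw [hpoly] at h1
  exact h1.symm.trans h2

/-- **`τ` fixes every determinant `det(a ∣ V₁) = ∏_φ φ(a)^{r_φ}` iff `r ∘ τ = r`** (the multiplicative twin of
`forall_apply_sum_eq_iff_forall_apply_smul_eq`). [cite: Kottwitz1992, §5 pp. 389–390] -/
theorem forall_apply_prod_pow_eq_iff (τ : ℂ ≃+* ℂ) :
    (∀ a : F, τ (∏ φ : F →+* ℂ, φ a ^ r φ) = ∏ φ : F →+* ℂ, φ a ^ r φ) ↔ ∀ φ : F →+* ℂ, r (τ • φ) = r φ := by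
  constructor
  · intro h φ
    have hfun : (fun ψ : F →+* ℂ => r (τ⁻¹ • ψ)) = r :=
      eq_of_forall_prod_apply_pow_eq fun a => by rw [← apply_prod_apply_pow, h a]
    have hφ := congr_fun hfun (τ • φ)
    simp only [inv_smul_smul] at hφ
    exact hφ.symm
  · intro h a
    rw [apply_prod_apply_pow]
    exact Finset.prod_congr rfl fun ψ _ => by rw [← h (τ⁻¹ • ψ), smul_inv_smul]

end Independence

/-! ## §2 `E_r = ℚ(det(a ∣ V₁) ∣ a ∈ F)` -/

section Determinants

variable (r : (F →+* ℂ) → ℕ)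

/-- `ℚ(det) ⊆ E_r` (g28-#4's «these coefficients lie in `E`», determinant form). [cite: Kottwitz1992, §5 p. 390] -/
theorem adjoin_prod_pow_le_adjoin_sum :
    IntermediateField.adjoin ℚ (Set.range fun a : F => ∏ φ : F →+* ℂ, φ a ^ r φ) ≤
      IntermediateField.adjoin ℚ (Set.range fun a : F => ∑ φ : F →+* ℂ, (r φ : ℂ) * φ a) := by
  rw [IntermediateField.adjoin_le_iff]
  rintro _ ⟨a, rfl⟩
  exact prod_apply_pow_mem_adjoin_sum r a

/-- `ℚ(det(a ∣ V₁) ∣ a ∈ F)` is a number field. [cite: Kottwitz1992, §5 p. 390] -/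
theorem finiteDimensional_adjoin_prod_pow :
    FiniteDimensional ℚ (IntermediateField.adjoin ℚ (Set.range fun a : F => ∏ φ : F →+* ℂ, φ a ^ r φ)) := by
  haveI := finiteDimensional_adjoin_sum r
  exact finiteDimensional_of_le_dt (adjoin_prod_pow_le_adjoin_sum r)

/-- **`Aut(ℂ/ℚ(det)) = Stab(r)`**: `τ` fixes the field generated by the determinants `det(a ∣ V₁)` pointwise iff
`r ∘ τ = r`. [cite: Kottwitz1992, §5 pp. 389–390] -/
theorem forall_mem_adjoin_prod_pow_iff (τ : ℂ ≃+* ℂ) :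
    (∀ z : ℂ, z ∈ IntermediateField.adjoin ℚ (Set.range fun a : F => ∏ φ : F →+* ℂ, φ a ^ r φ) → τ z = z) ↔
      ∀ φ : F →+* ℂ, r (τ • φ) = r φ := by
  rw [← forall_apply_prod_pow_eq_iff]
  constructor
  · intro h a
    exact h _ (IntermediateField.subset_adjoin ℚ _ ⟨a, rfl⟩)
  · intro h
    -- the fixed points of `τ` form an intermediate field containing the generators
    have hq : ∀ q : ℚ, τ (algebraMap ℚ ℂ q) = algebraMap ℚ ℂ q := fun q => by
      rw [eq_ratCast]; exact map_ratCast τ q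
    let f : ℂ →ₐ[ℚ] ℂ := (AlgEquiv.ofRingEquiv (f := τ) hq).toAlgHom
    let D : IntermediateField ℚ ℂ :=
      ⟨AlgHom.equalizer f (AlgHom.id ℚ ℂ), fun y (hy : τ y = y) => show τ y⁻¹ = y⁻¹ by rw [map_inv₀, hy]⟩
    have hle : IntermediateField.adjoin ℚ (Set.range fun a : F => ∏ φ : F →+* ℂ, φ a ^ r φ) ≤ D := by
      rw [IntermediateField.adjoin_le_iff]
      rintro _ ⟨a, rfl⟩
      exact h a
    exact fun z hz => hle hz

/-- **THE REFLEX FIELD IS GENERATED BY THE DETERMINANTS: `ℚ(∏_φ φ(a)^{r_φ} ∣ a ∈ F) = E_r`** — the field of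
definition `E` of the class of `V₁` is the field of definition of `det_{V₁}`, because `det_V` determines `V` (Kottwitz);
`⊆` is «these coefficients lie in `E`», `⊇` is §1 through the Galois correspondence in `ℂ`.
[cite: Kottwitz1992, §5 pp. 389–390] [cite: Lang2002, Ch. VIII §1] -/
theorem adjoin_prod_pow_eq_adjoin_sum :
    IntermediateField.adjoin ℚ (Set.range fun a : F => ∏ φ : F →+* ℂ, φ a ^ r φ) =
      IntermediateField.adjoin ℚ (Set.range fun a : F => ∑ φ : F →+* ℂ, (r φ : ℂ) * φ a) := by
  refine le_antisymm (adjoin_prod_pow_le_adjoin_sum r) ?_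
  haveI := finiteDimensional_adjoin_prod_pow r
  exact (adjoin_sum_le_iff_forall r _).2 fun τ hτ => (forall_mem_adjoin_prod_pow_iff r τ).1 hτ

/-- `z ∈ ℚ(det)` iff `z` is fixed by `Stab(r)` (the fixed field of the stabiliser, determinant presentation).
[cite: Kottwitz1992, §5 pp. 389–390] [cite: Lang2002, Ch. VIII §1] -/
theorem mem_adjoin_prod_pow_iff_forall (z : ℂ) :
    z ∈ IntermediateField.adjoin ℚ (Set.range fun a : F => ∏ φ : F →+* ℂ, φ a ^ r φ) ↔
      ∀ τ : ℂ ≃+* ℂ, (∀ φ : F →+* ℂ, r (τ • φ) = r φ) → τ z = z := by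
  rw [adjoin_prod_pow_eq_adjoin_sum]
  exact mem_adjoin_sum_iff_forall r z

end Determinants

/-! ## §3 `E_r` is generated by the coefficients of the polynomials `det(X − a ∣ V₁)` -/

section Coefficients

variable (r : (F →+* ℂ) → ℕ)

omit [NumberField F] in
/-- The constant coefficient of `∏_φ (X − φ(a))^{r_φ}` is `(−1)^{∑ r} ∏_φ φ(a)^{r_φ} = ± det(a ∣ V₁)`.
[cite: Kottwitz1992, §5 p. 390] -/
theorem coeff_zero_prod_X_sub_C_pow [Fintype (F →+* ℂ)] (a : F) :
    (∏ φ : F →+* ℂ, (X - C (φ a : ℂ)) ^ r φ).coeff 0 = (-1) ^ (∑ φ : F →+* ℂ, r φ) * ∏ φ : F →+* ℂ, φ a ^ r φ := by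
  rw [coeff_zero_eq_eval_zero, eval_prod]
  have h : ∀ φ : F →+* ℂ, eval 0 ((X - C (φ a : ℂ)) ^ r φ) = (-1) ^ r φ * φ a ^ r φ := fun φ => by
    rw [eval_pow, eval_sub, eval_X, eval_C, zero_sub, neg_eq_neg_one_mul, mul_pow]
  rw [Finset.prod_congr rfl fun φ _ => h φ, Finset.prod_mul_distrib, Finset.prod_pow_eq_pow_sum]

/-- **`E_r = ℚ(`coefficients of `det(X − a ∣ V₁)`, `a ∈ F)`**: the field generated by ALL coefficients of the polynomials
`∏_φ (X − φ(a))^{r_φ}` is the reflex field (`⊆`: g28-#4's «these coefficients lie in `E`»; `⊇`: it contains the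
determinants `± coeff₀`, which generate `E_r` by §2). [cite: Kottwitz1992, §5 pp. 389–390] -/
theorem adjoin_coeff_prod_X_sub_C_pow_eq_adjoin_sum :
    IntermediateField.adjoin ℚ (Set.range fun p : F × ℕ => (∏ φ : F →+* ℂ, (X - C (φ p.1 : ℂ)) ^ r φ).coeff p.2) =
      IntermediateField.adjoin ℚ (Set.range fun a : F => ∑ φ : F →+* ℂ, (r φ : ℂ) * φ a) := by
  apply le_antisymm
  · rw [IntermediateField.adjoin_le_iff, Set.range_subset_iff]
    intro p
    exact coeff_prod_X_sub_C_pow_mem_adjoin_sum r p.1 p.2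
  · rw [← adjoin_prod_pow_eq_adjoin_sum, IntermediateField.adjoin_le_iff, Set.range_subset_iff]
    intro a
    have h0 : (∏ φ : F →+* ℂ, (X - C (φ a : ℂ)) ^ r φ).coeff 0 ∈
        IntermediateField.adjoin ℚ (Set.range fun p : F × ℕ => (∏ φ : F →+* ℂ, (X - C (φ p.1 : ℂ)) ^ r φ).coeff p.2) :=
      IntermediateField.subset_adjoin ℚ _ ⟨(a, 0), rfl⟩
    have hc := coeff_zero_prod_X_sub_C_pow r a
    have hunit : ((-1 : ℂ) ^ (∑ φ : F →+* ℂ, r φ)) * (-1) ^ (∑ φ : F →+* ℂ, r φ) = 1 := by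
      rw [← mul_pow, neg_one_mul, neg_neg, one_pow]
    have h1 : ∏ φ : F →+* ℂ, φ a ^ r φ =
        (-1) ^ (∑ φ : F →+* ℂ, r φ) * (∏ φ : F →+* ℂ, (X - C (φ a : ℂ)) ^ r φ).coeff 0 := by
      rw [hc, ← mul_assoc, hunit, one_mul]
    have hmem : ∏ φ : F →+* ℂ, φ a ^ r φ ∈
        IntermediateField.adjoin ℚ (Set.range fun p : F × ℕ => (∏ φ : F →+* ℂ, (X - C (φ p.1 : ℂ)) ^ r φ).coeff p.2) := by
      rw [h1]
      exact mul_mem (pow_mem (neg_mem (one_mem _)) _) h0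
    exact hmem

end Coefficients

/-! ## §4 `E_r` is generated by the values of Kottwitz's `f(X₁, …, X_t) = det(∑ Xᵢαᵢ ∣ V₁)` at rational points -/

section KottwitzF

variable (r : (F →+* ℂ) → ℕ)

/-- `f(x) = det(∑ᵢ xᵢαᵢ ∣ V₁) = ∏_φ (∑ᵢ xᵢ φ(αᵢ))^{r_φ}` for `x ∈ ℚ^t`: the value of Kottwitz's polynomial at a rational
point is the determinant of the element `∑ xᵢ αᵢ ∈ F`. [cite: Kottwitz1992, §5 pp. 389–390] -/
theorem prod_sum_mul_apply_pow_eq {ι : Type} [Fintype ι] (α : ι → F) (x : ι → ℚ) :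
    ∏ φ : F →+* ℂ, (∑ i, (x i : ℂ) * φ (α i)) ^ r φ = ∏ φ : F →+* ℂ, φ (∑ i, x i • α i) ^ r φ := by
  refine Finset.prod_congr rfl fun φ _ => ?_
  rw [map_sum]
  congr 1
  refine Finset.sum_congr rfl fun i _ => ?_
  rw [Rat.smul_def, map_mul, map_ratCast]

/-- **`E_r = ℚ(f(x) ∣ x ∈ ℚ^t)`**: for a `ℚ`-basis `α₁, …, α_t` of `F`, the reflex field is generated by the values
`f(x) = ∏_φ (∑ᵢ xᵢ φ(αᵢ))^{r_φ}` of Kottwitz's `f = det(X₁α₁ + ⋯ + X_tα_t ; V₁)` at rational points (these are exactly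
the determinants `det(a ∣ V₁)`, `a ∈ F`). [cite: Kottwitz1992, §5 pp. 389–390] -/
theorem adjoin_prod_pow_repr_eq_adjoin_sum {ι : Type} [Fintype ι] (α : Basis ι ℚ F) :
    IntermediateField.adjoin ℚ (Set.range fun x : ι → ℚ => ∏ φ : F →+* ℂ, (∑ i, (x i : ℂ) * φ (α i)) ^ r φ) =
      IntermediateField.adjoin ℚ (Set.range fun a : F => ∑ φ : F →+* ℂ, (r φ : ℂ) * φ a) := by
  have hrange : (Set.range fun x : ι → ℚ => ∏ φ : F →+* ℂ, (∑ i, (x i : ℂ) * φ (α i)) ^ r φ) =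
      Set.range fun a : F => ∏ φ : F →+* ℂ, φ a ^ r φ := by
    have hcomp : (fun x : ι → ℚ => ∏ φ : F →+* ℂ, (∑ i, (x i : ℂ) * φ (α i)) ^ r φ) =
        (fun a : F => ∏ φ : F →+* ℂ, φ a ^ r φ) ∘ fun x : ι → ℚ => ∑ i, x i • α i :=
      funext fun x => prod_sum_mul_apply_pow_eq r α x
    rw [hcomp]
    refine Function.Surjective.range_comp ?_ _
    intro a
    refine ⟨fun i => α.repr a i, ?_⟩
    change ∑ i, α.repr a i • α i = a
    rw [α.sum_repr]
  rw [hrange, adjoin_prod_pow_eq_adjoin_sum]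

end KottwitzF

/-! ## §5 `r = 𝟙_Φ`: the reflex field of a CM type is generated by the type norms -/

section TypeNorm

omit [NumberField F] in
/-- `∏_φ φ(a)^{𝟙_Φ(φ)} = ∏_{φ ∈ Φ} φ(a) = N_Φ(a)`, the type norm. [cite: Shimura1998, §8.3 Prop. 29] -/
theorem prod_pow_ite_eq_prod_toFinset [Fintype (F →+* ℂ)] (Φ : CMType F) (a : F) :
    ∏ φ : F →+* ℂ, φ a ^ (if φ ∈ Φ.1 then 1 else 0 : ℕ) = ∏ φ ∈ Φ.1.toFinset, φ a := by
  rw [← Finset.prod_filter_of_ne (s := Finset.univ) (p := fun φ : F →+* ℂ => φ ∈ Φ.1)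
    (f := fun φ : F →+* ℂ => φ a ^ (if φ ∈ Φ.1 then 1 else 0 : ℕ))]
  · have hS : Finset.univ.filter (fun φ : F →+* ℂ => φ ∈ Φ.1) = Φ.1.toFinset := by
      ext φ
      simp only [Finset.mem_filter, Finset.mem_univ, true_and, Set.mem_toFinset]
    rw [hS]
    refine Finset.prod_congr rfl fun φ hφ => ?_
    rw [Set.mem_toFinset] at hφ
    rw [if_pos hφ, pow_one]
  · intro φ _ hne
    by_contra hφ
    rw [if_neg hφ, pow_zero] at hne
    exact hne rfl

/-- **`K* = ℚ(N_Φ(a) ∣ a ∈ K)`: THE REFLEX FIELD OF A CM TYPE IS GENERATED BY THE TYPE NORMS** (`K* = ℚ(tr_Φ)` is the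
tree's `traceField`, Shimura's Prop. 28; the type norms `β = ∏ᵢ α^{φᵢ}` of Prop. 29 lie in it and generate it, by §2 for
the indicator signature `𝟙_Φ`). [cite: Shimura1998, §8.3 Prop. 28 and Prop. 29] [cite: Kottwitz1992, §5 pp. 389–390] -/
theorem traceField_eq_adjoin_prod (Φ : CMType F) :
    traceField Φ = IntermediateField.adjoin ℚ (Set.range fun a : F => ∏ φ ∈ Φ.1.toFinset, φ a) := by
  have h := adjoin_prod_pow_eq_adjoin_sum (fun φ : F →+* ℂ => if φ ∈ Φ.1 then 1 else 0)
  rw [adjoin_sum_indicator_eq_traceField] at h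
  rw [← h]
  have hfun : (fun a : F => ∏ φ : F →+* ℂ, φ a ^ (if φ ∈ Φ.1 then 1 else 0 : ℕ)) =
      fun a : F => ∏ φ ∈ Φ.1.toFinset, φ a := funext fun a => prod_pow_ite_eq_prod_toFinset Φ a
  rw [hfun]

/-- `τ` fixes every type norm `N_Φ(a)` iff `τΦ = Φ` (multiplicative independence, `r = 𝟙_Φ`).
[cite: Shimura1998, §8.3 Prop. 28 and Prop. 29] -/
theorem forall_apply_prod_toFinset_eq_iff (Φ : CMType F) (τ : ℂ ≃+* ℂ) :
    (∀ a : F, τ (∏ φ ∈ Φ.1.toFinset, φ a) = ∏ φ ∈ Φ.1.toFinset, φ a) ↔ ∀ χ : F →+* ℂ, τ • χ ∈ Φ.1 ↔ χ ∈ Φ.1 := by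
  rw [← forall_indicator_smul_eq_iff Φ τ]
  have h := forall_apply_prod_pow_eq_iff (fun ψ : F →+* ℂ => if ψ ∈ Φ.1 then 1 else 0) τ
  refine Iff.trans (forall_congr' fun a => ?_) h
  rw [prod_pow_ite_eq_prod_toFinset Φ a]

end TypeNorm

end Literature.NumberTheory.ComplexMultiplication
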